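import Summits.Ventures.PercRepro2.CaseOneMarkMoves
import Summits.Ventures.PercRepro2.CaseOnePocketT

/-!
# The six-form calculus: a pendant mark `o` or `b` is pulled back to its neighbour
(blind cell PercRepro2, p1 g31)

For `o` a leaf at `y` the T-pair scales exactly like the Q-pair: `P(T, o ∈ U) = p(e₀) · P(T, y ∈ U)`
of `G − e₀` (**`Dto_o_move`**, the twin of `Dqo_o_move`) while `P(T)` is unchanged (`Dt_restrict`); with
`iiExprT_o_move` / `iExprT_o_move` and the linearity of the forms in the pair, `(ii-T)(G, o) =
p(e₀) · (ii-T)(G − e₀, y)` — **`sixForms_of_o_move`**. For `b` a leaf at `y` the T-pair is unchanged and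
the forms carry the factor `p(e₀)` (`iiExprT_b_move`) — **`sixForms_of_b_move`**. Hence the six-form
twins of the mark moves: **`closedAtT_of_o_move`**, **`closedAtT_of_b_move`**,
**`closedAtT_of_o_pocket_move`**, **`closedAtT_of_b_pocket_move`**. Own code; standard axioms.
-/

namespace Summit.Ventures.PercRepro2

namespace CaseOne

/-! ## The T-pair under an `o`-move -/

section OMoveT
variable {V : Type*} {E : Type*} [Fintype E] [DecidableEq E] {R : Type*} [CommRing R]
variable {ends : E → Sym2 V} {o a₁ a₂ a₃ y : V} {e₀ : E}

/-- `P(T, o ∈ U)` for `o` pendant at `y`: `p(e₀)` times `P(T, y ∈ U)` of `G − e₀`. -/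
lemma Dto_o_move (p : E → R) (hl : IsLeafAt ends y o e₀) (h1 : a₁ ≠ o) (h2 : a₂ ≠ o) (h3 : a₃ ≠ o) :
    Dto p ends o a₁ a₂ a₃ = p e₀ * Dto (restrictW p e₀) (restrictEnds ends e₀) y a₁ a₂ a₃ := by
  unfold Dto
  have e : (connEvent ends a₁ o ∪ connEvent ends a₂ o) ∩ connEvent ends a₂ a₃ ∩
      (connEvent ends a₁ a₂)ᶜ = (connEvent ends a₁ o ∪ connEvent ends a₂ o) ∩
      (connEvent ends a₂ a₃ ∩ (connEvent ends a₁ a₂)ᶜ) := by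
    simp only [Set.inter_assoc]
  rw [e, o_move_setU hl h1 h2, prob_connEvent_leaf_inter p hl]
  · congr 1
    have e' : (connEvent ends a₁ y ∪ connEvent ends a₂ y) ∩
        (connEvent ends a₂ a₃ ∩ (connEvent ends a₁ a₂)ᶜ) = (connEvent ends a₁ y ∪ connEvent ends a₂ y) ∩
        connEvent ends a₂ a₃ ∩ (connEvent ends a₁ a₂)ᶜ := by
      simp only [Set.inter_assoc]
    rw [e', connEvent_restrict hl h1 hl.ne, connEvent_restrict hl h2 hl.ne,
      connEvent_restrict hl h2 h3, connEvent_restrict hl h1 h2]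
    simp only [← Set.preimage_compl, ← Set.preimage_inter, ← Set.preimage_union, prob_restrict]
  · intro ω c
    simp only [Set.mem_inter_iff, Set.mem_union, Set.mem_compl_iff]
    rw [mem_connEvent_update_of_leaf hl ω c h1 hl.ne, mem_connEvent_update_of_leaf hl ω c h2 hl.ne,
      mem_connEvent_update_of_leaf hl ω c h2 h3, mem_connEvent_update_of_leaf hl ω c h1 h2]

end OMoveT

/-! ## The six forms under the two mark moves -/

section MovesSix
variable {V : Type*} {E : Type*} [Fintype E] [DecidableEq E] {R : Type*} [Field R] [LinearOrder R]
  [IsStrictOrderedRing R]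
variable {ends : E → Sym2 V} {o a₁ a₂ a₃ b y : V} {e₀ : E}

/-- **The six forms at `a₃` for `(G − e₀, y)` give them for `(G, o)`** when `o` is a leaf at `y`. -/
theorem sixForms_of_o_move {p : E → R} (hp : IsProbVec p) (hl : IsLeafAt ends y o e₀) (h1 : a₁ ≠ o)
    (h2 : a₂ ≠ o) (h3 : a₃ ≠ o) (hb : b ≠ o)
    (h : SixForms (restrictW p e₀) (restrictEnds ends e₀) y a₁ a₂ a₃ b) :
    SixForms p ends o a₁ a₂ a₃ b := by
  obtain ⟨hii, hiiq, hiit, hi, hiq, hit⟩ := h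
  have h4 := fourForms_of_o_move hp hl h1 h2 h3 hb ⟨hii, hiiq, hi, hiq⟩
  have hq := hp.nonneg e₀
  refine ⟨h4.1, h4.2.1, ?_, h4.2.2.1, h4.2.2.2, ?_⟩
  · unfold ZSplitIIT
    rw [iiExprT_o_move p hl h1 h2 h3 hb, Dto_o_move p hl h1 h2 h3, Dt_restrict p hl h1 h2 h3,
      iiExprT_mul_pair]
    exact mul_nonneg hq hiit
  · unfold ZSplitIT
    rw [iExprT_o_move p hl h1 h2 h3 hb, Dto_o_move p hl h1 h2 h3, Dt_restrict p hl h1 h2 h3,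
      iExprT_mul_pair]
    exact mul_nonneg hq hit

/-- **The six forms at `a₃` for `(G − e₀, y)` give them for `(G, b)`** when `b` is a leaf at `y`. -/
theorem sixForms_of_b_move {p : E → R} (hp : IsProbVec p) (hl : IsLeafAt ends y b e₀) (ho : o ≠ b)
    (h1 : a₁ ≠ b) (h2 : a₂ ≠ b) (h3 : a₃ ≠ b)
    (h : SixForms (restrictW p e₀) (restrictEnds ends e₀) o a₁ a₂ a₃ y) :
    SixForms p ends o a₁ a₂ a₃ b := by
  obtain ⟨hii, hiiq, hiit, hi, hiq, hit⟩ := h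
  have h4 := fourForms_of_b_move hp hl ho h1 h2 h3 ⟨hii, hiiq, hi, hiq⟩
  have hq := hp.nonneg e₀
  refine ⟨h4.1, h4.2.1, ?_, h4.2.2.1, h4.2.2.2, ?_⟩
  · unfold ZSplitIIT
    rw [iiExprT_b_move p hl ho h1 h2 h3, Dto_restrict p hl ho h1 h2 h3, Dt_restrict p hl h1 h2 h3]
    exact mul_nonneg hq hiit
  · unfold ZSplitIT
    rw [iExprT_b_move p hl ho h1 h2 h3, Dto_restrict p hl ho h1 h2 h3, Dt_restrict p hl h1 h2 h3]
    exact mul_nonneg hq hit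

/-- **A pendant `o` is replaced by its neighbour, for the six-form closed property.** -/
theorem closedAtT_of_o_move (hl : IsLeafAt ends y o e₀) (h1 : a₁ ≠ o) (h2 : a₂ ≠ o) (h3 : a₃ ≠ o)
    (hb : b ≠ o) (hc : ClosedAtT (R := R) y a₁ a₂ b {e : E // e ≠ e₀} (restrictEnds ends e₀) a₃) :
    ClosedAtT (R := R) o a₁ a₂ b E ends a₃ :=
  fun p hp => sixForms_of_o_move hp hl h1 h2 h3 hb (hc (restrictW p e₀) (IsProbVec.restrictW hp e₀))

/-- **A pendant `b` is replaced by its neighbour, for the six-form closed property.** -/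
theorem closedAtT_of_b_move (hl : IsLeafAt ends y b e₀) (ho : o ≠ b) (h1 : a₁ ≠ b) (h2 : a₂ ≠ b)
    (h3 : a₃ ≠ b) (hc : ClosedAtT (R := R) o a₁ a₂ y {e : E // e ≠ e₀} (restrictEnds ends e₀) a₃) :
    ClosedAtT (R := R) o a₁ a₂ b E ends a₃ :=
  fun p hp => sixForms_of_b_move hp hl ho h1 h2 h3 (hc (restrictW p e₀) (IsProbVec.restrictW hp e₀))

variable {W : Set V} {P : Finset E}

/-- **The mark `o` alone in a mark-free-otherwise pocket at `y` is replaced by `y`** (six forms). -/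
theorem closedAtT_of_o_pocket_move (h : IsPocket ends W y P) (he : e₀ ∈ P) (ho : o ∈ W)
    (h1 : a₁ ∉ W) (h2 : a₂ ∉ W) (ha : a₃ ∉ W) (hb : b ∉ W)
    (hc : ClosedAtT (R := R) y a₁ a₂ b {e : E // e ≠ e₀}
      (restrictEnds (pocketEnds ends P e₀ o y) e₀) a₃) :
    ClosedAtT (R := R) o a₁ a₂ b E ends a₃ :=
  closedAtT_of_pocket' (z := o) h he (Or.inr rfl) (Or.inl h1) (Or.inl h2) (Or.inl ha) (Or.inl hb)
    (closedAtT_of_o_move (h.isLeafAt_pocketEnds e₀ ho) (by rintro rfl; exact h1 ho)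
      (by rintro rfl; exact h2 ho) (by rintro rfl; exact ha ho) (by rintro rfl; exact hb ho) hc)

/-- **The mark `b` alone in a mark-free-otherwise pocket at `y` is replaced by `y`** (six forms). -/
theorem closedAtT_of_b_pocket_move (h : IsPocket ends W y P) (he : e₀ ∈ P) (hb : b ∈ W)
    (ho : o ∉ W) (h1 : a₁ ∉ W) (h2 : a₂ ∉ W) (ha : a₃ ∉ W)
    (hc : ClosedAtT (R := R) o a₁ a₂ y {e : E // e ≠ e₀}
      (restrictEnds (pocketEnds ends P e₀ b y) e₀) a₃) :
    ClosedAtT (R := R) o a₁ a₂ b E ends a₃ :=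
  closedAtT_of_pocket' (z := b) h he (Or.inl ho) (Or.inl h1) (Or.inl h2) (Or.inl ha) (Or.inr rfl)
    (closedAtT_of_b_move (h.isLeafAt_pocketEnds e₀ hb) (by rintro rfl; exact ho hb)
      (by rintro rfl; exact h1 hb) (by rintro rfl; exact h2 hb) (by rintro rfl; exact ha hb) hc)

end MovesSix

end CaseOne

end Summit.Ventures.PercRepro2
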